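import Summits.QuantumFields.YangMills.Theorems.UnitScaleTiltProp7TwistedTowerFramesT3
import Summits.QuantumFields.YangMills.Theorems.UnitScaleTiltProp7LogRemainderMass
import HarnessLib

/-!
# `UnitScaleTiltProp7StairRem2Row` — THE STAIR ROW OF THE SECOND-ORDER FRAME RECURSION, READ ON THE PLAIN TOWER (R0-RECURSION file F-β):
# **`‖V(Γ_i(y))V₀(Γ_i(y))* − 1 − Y^{lin}_{V₀}(Γ_i(y))‖ ≤ (9L²∕2)·B(y) + (3L∕2)·D(y)`** per centre staircase and, summed over the coarse sites with the index mean,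
# **`Σ_y |Idx|⁻¹Σ_i SR y i ≤ (9L²∕2)·Σ_y B(y) + (3L∕2)·Σ_{b : PBond P k} D b`** — the `SR` letter of ✓`Prop7FrameRem2Step.frameRem2_step_le` in terms of the single-bar level mass `B` and ONE
# new displayed letter: the PLAIN tower's second-order single-bar remainder `‖pertVar V₀ V b − ℓY b‖ ≤ D b` («(n3)₂-sym»)
(route `UnitScaleTilt`, crux K1 «MinimiserStabilityRegPr» stmt-QuantumFields-19200; ★★OWNER ym3-torus-plan g29 RULING №19 (3)∕№20 «R0-RECURSION := px13 g6»; LOCATE `LOCATE-R0-RECURSION-px13g6.md`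
(19200 evidence #57) §2 + ADDENDUM A1 (bus 2026-08-29T05:57:58Z: the stair row reads the PLAIN tower — the covariant tower's defects would re-introduce the centre frame undamped); def-free, count-neutral).
Cell `ym3-torus` (HUMAN RULING D-0037, YM ladder rung R3 — YM₃ on T³ is a rung, not d = 4, not infinite volume, not a mass gap, not Clay), width seat `ym3-torus-px13` (gen 6).

THE PRINT.  [Balaban1985Averaging] (56)–(58) p. 27 (parallel transport along the (0.3)∕(0.4) staircases), Prop. 3 (122)–(123) p. 36 (holonomy of a near-unit perturbation to first order with a
quadratic remainder); [Balaban1987RG1] (0.3) p. 252 (the staircases stay in the block).  The tree has the second-order walk lemma ✓`Prop7HolRatioPerStep.norm_holRatio_sub_covWalkSum_le_two_mul_sq`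
(`‖V(Γ)V₀(Γ)* − 1 − Y_{V₀}(Γ)‖ ≤ 2(Σ_Γ‖Y‖)²`, `Y = pertVar V₀ V`) and the first-order stair row ✓`Prop7TwistedTowerFramesT3.stair_row_of_twoBlockSup`; this file is the second-order stair row in the
same letters.

WHAT IS PROVED (sorry-free, no definition; `d = 3`, level `k` with `k + 1 ≤ m + K`, `SU(2)` fields `V₀ V : GaugeField P k SU(2)` = the background and competitor PLAIN towers read at level `k`;
`Y := pertVar V₀ V`; ABSTRACT linear parts `ℓY : PBond P k → M₂(ℂ)` with the displayed remainder majorant `hD : ‖Y b − ℓY b‖ ≤ D b`; `B(y) := Σ_{b ∈ B(y)}‖Y b‖²`, `D(y) := Σ_{b ∈ B(y)} D b`):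
* §1 [folklore] `sum_sum_filter_blockOf_eq` (the bonds are tiled by the blocks of their sources); `walkSum_le_length_mul_blockSum` (`Σ_{s∈Γ} D(b(s)) ≤ |Γ|·D(y)` for walks in `B(y)`).
* §2 ★★ `norm_stairRatio_sub_one_sub_lin_le` — POINTWISE: for every coarse site `y` and index `i`, with `Γ = walk (emb y) (stairWord i.2.1 (off i.1))` and walk mass `≤ 1`,
  `‖V(Γ)V₀(Γ)* − 1 − covWalkSum V₀ ℓY Γ‖ ≤ (9L²∕2)·B(y) + (3L∕2)·D(y)` (✓two_mul_sq ∘ ✓`covWalkSum_sub` ∘ ✓`norm_covWalkSum_le_mass` ∘ ✓`walkSum_le_length_mul_sqrt` ∘ ✓`length_walk_stairWord_le` ∘ lit ✓`stair_src_tgt_blockOf`).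
* §3 ★★★ `sum_idxMean_stairRem2_le` — SUMMED with the index mean: `Σ_y |Idx|⁻¹Σ_i ‖…‖ ≤ (9L²∕2)·Σ_y B(y) + (3L∕2)·Σ_{b : PBond P k} D b`; and ★★★ `sum_idxMean_le_of_stairRem2` — the same for any
  majorant family `SR y i` chosen EQUAL to the pointwise right side (the form ✓`frameRem2_step_le` consumes: `SR y i := (9L²∕2)B(y) + (3L∕2)D(y)`, `Σ_y|Idx|⁻¹Σ_i SR y i = (9L²∕2)ΣB + (3L∕2)ΣD`).
HONEST FRAMING.  Bookkeeping over landed walk lemmas; the letter `D` («(n3)₂-sym»: the plain symmetric tower's second-order single-bar remainder in ℓ¹) is DISPLAYED, not proved — its supplier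
(one-step ✓`Prop7AvgTrueLinearisation.norm_avgFun_ratio_sub_one_sub_trueLin_le` + an ℓ¹ propagation) is not in the tree; nothing of REM2ˢ∕(R0)∕(β)∕hPA2∕hcoS∕E′∕EX∕the crux is proved; rung R3,
not Clay; YM gap NOT proved.  `--supports stmt-QuantumFields-19200 --as helper`.
References: T. Bałaban, CMP 98 (1985) 17–51 [Balaban1985Averaging] ((56)–(58) p.27, Prop. 3 (122)–(123) p.36); CMP 109 (1987) 249–301 [Balaban1987RG1] ((0.3)–(0.4) pp.252–253).
-/

set_option autoImplicit false

noncomputable section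

open scoped BigOperators Matrix.Norms.L2Operator

namespace Summit.QuantumFields.YangMills.Theorems.Prop7StairRem2Row

open Finset
open Literature.MathematicalPhysics.QuantumFieldTheory.Balaban1983to89
open T4Continuum T4ReflectionCone BlockAveraging AveragingRT BlockAveragingEMLLinearisedBackground
open Summit.QuantumFields.YangMills.Theorems.Prop7HolRatioPerStep (norm_holRatio_sub_covWalkSum_le_two_mul_sq norm_covWalkSum_le_mass)
open Summit.QuantumFields.YangMills.Theorems.Prop7LogRemainderMass (covWalkSum_sub)
open Summit.QuantumFields.YangMills.Theorems.Prop7TwistedTowerFramesT3 (walkSum_le_length_mul_sqrt length_walk_stairWord_le)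
open Summit.QuantumFields.YangMills.Theorems.Prop7BlockMeanContraction (idxMean_eq_blockMean)

variable {P : Params} {k : ℕ}

/-! ## §1 Bookkeeping: bonds tiled by the blocks of their sources; walk sums against block sums -/

/-- the level-`k` bonds are tiled by the blocks of their sources: `Σ_y Σ_{b : blockOf b₋ = y} f b = Σ_b f b`. [cite: Balaban1987RG1, (0.3) p.252] -/
theorem sum_sum_filter_blockOf_eq (f : PBond P k → ℝ) :
    ∑ y : Site P (k + 1), ∑ b ∈ univ.filter (fun b : PBond P k => blockOf b.src = y), f b = ∑ b : PBond P k, f b :=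
  Finset.sum_fiberwise_of_maps_to (g := fun b : PBond P k => blockOf b.src) (fun _ _ => Finset.mem_univ _) f

/-- a walk whose bonds start in `B(y)`: `Σ_{s∈Γ} D(b(s)) ≤ |Γ|·Σ_{b ∈ B(y)} D b` for a non-negative `D` (each term is at most the block sum). [folklore] -/
theorem walkSum_le_length_mul_blockSum (D : PBond P k → ℝ) (hD0 : ∀ b, 0 ≤ D b) (y : Site P (k + 1)) :
    ∀ γ : List (LStep P k), (∀ s ∈ γ, blockOf s.bond.src = y) →
      (γ.map fun s => D s.bond).sum ≤ (γ.length : ℝ) * ∑ b ∈ univ.filter (fun b : PBond P k => blockOf b.src = y), D b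
  | [], _ => by simp
  | s :: γ, h => by
    rw [List.map_cons, List.sum_cons, List.length_cons]
    push_cast
    have hs : D s.bond ≤ ∑ b ∈ univ.filter (fun b : PBond P k => blockOf b.src = y), D b :=
      Finset.single_le_sum (f := D) (fun b _ => hD0 b) (Finset.mem_filter.2 ⟨Finset.mem_univ _, h s List.mem_cons_self⟩)
    have ih := walkSum_le_length_mul_blockSum D hD0 y γ fun s' hs' => h s' (List.mem_cons_of_mem _ hs')
    linarith

/-! ## §2 ★★ The second-order stair row, pointwise -/

/-- ★★ **THE STAIR RATIO TO SECOND ORDER** (d = 3, level `k`, `k + 1 ≤ m + K`): for `SU(2)` fields `V₀, V` at level `k` with `Y := pertVar V₀ V`, abstract linear parts `ℓY` with `‖Y b − ℓY b‖ ≤ D b`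
(`D ≥ 0`), and a centre staircase `Γ = walk (emb y) (stairWord i.2.1 (off i.1))` of walk mass `Σ_Γ‖Y‖ ≤ 1`:
`‖V(Γ)V₀(Γ)* − 1 − covWalkSum V₀ ℓY Γ‖ ≤ (9L²∕2)·Σ_{b∈B(y)}‖Y b‖² + (3L∕2)·Σ_{b∈B(y)} D b`. [cite: Balaban1985Averaging, (56)-(58) p.27, Prop. 3 (122)-(123) p.36; Balaban1987RG1, (0.3) p.252] -/
theorem norm_stairRatio_sub_one_sub_lin_le (hd : P.d = 3) (hk : k + 1 ≤ P.m + P.K) (V₀ V : GaugeField P k (Matrix.specialUnitaryGroup (Fin 2) ℂ))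
    (ℓY : PBond P k → Matrix (Fin 2) (Fin 2) ℂ) (D : PBond P k → ℝ) (hD0 : ∀ b, 0 ≤ D b) (hD : ∀ b, ‖pertVar V₀ V b - ℓY b‖ ≤ D b)
    (y : Site P (k + 1)) (i : Idx P)
    (hm : ((walk (emb y) (stairWord i.2.1 (off i.1))).map fun s => ‖pertVar V₀ V s.bond‖).sum ≤ 1) :
    ‖((holAt V (walk (emb y) (stairWord i.2.1 (off i.1))) : Matrix.specialUnitaryGroup (Fin 2) ℂ) : Matrix (Fin 2) (Fin 2) ℂ)
          * star ((holAt V₀ (walk (emb y) (stairWord i.2.1 (off i.1))) : Matrix.specialUnitaryGroup (Fin 2) ℂ) : Matrix (Fin 2) (Fin 2) ℂ) - 1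
        - covWalkSum V₀ ℓY (walk (emb y) (stairWord i.2.1 (off i.1)))‖
      ≤ 9 * (P.L : ℝ) ^ 2 / 2 * ∑ b ∈ univ.filter (fun b : PBond P k => blockOf b.src = y), ‖pertVar V₀ V b‖ ^ 2
        + 3 * (P.L : ℝ) / 2 * ∑ b ∈ univ.filter (fun b : PBond P k => blockOf b.src = y), D b := by
  set Γ := walk (emb y) (stairWord i.2.1 (off i.1)) with hΓ
  have hblk : ∀ s ∈ Γ, blockOf s.bond.src = y := fun s hs => (B12B0LoopGeometry267.stair_src_tgt_blockOf hk y i.2.1 i.1 s hs).1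
  have hlen : (Γ.length : ℝ) ≤ 3 * (P.L : ℝ) / 2 := length_walk_stairWord_le hd y i
  -- the quadratic holonomy remainder
  have h2 := norm_holRatio_sub_covWalkSum_le_two_mul_sq V₀ V Γ hm
  -- the linear-part remainder along the walk
  have hlin : ‖covWalkSum V₀ (pertVar V₀ V) Γ - covWalkSum V₀ ℓY Γ‖ ≤ (Γ.length : ℝ) * ∑ b ∈ univ.filter (fun b : PBond P k => blockOf b.src = y), D b := by
    rw [← covWalkSum_sub]
    refine (norm_covWalkSum_le_mass V₀ (pertVar V₀ V - ℓY) Γ).trans ?_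
    refine le_trans ?_ (walkSum_le_length_mul_blockSum D hD0 y Γ hblk)
    exact List.sum_le_sum fun s _ => hD s.bond
  -- the walk mass against the block mass
  have hws := walkSum_le_length_mul_sqrt (pertVar V₀ V) y Γ hblk
  set S : ℝ := (Γ.map fun s => ‖pertVar V₀ V s.bond‖).sum with hS
  set Bq : ℝ := ∑ b ∈ univ.filter (fun b : PBond P k => blockOf b.src = y), ‖pertVar V₀ V b‖ ^ 2 with hBq
  set Dq : ℝ := ∑ b ∈ univ.filter (fun b : PBond P k => blockOf b.src = y), D b with hDq
  have hS0 : 0 ≤ S := List.sum_nonneg fun x hx => by obtain ⟨s', _, rfl⟩ := List.mem_map.1 hx; exact norm_nonneg _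
  have hBq0 : 0 ≤ Bq := Finset.sum_nonneg fun _ _ => sq_nonneg _
  have hDq0 : 0 ≤ Dq := Finset.sum_nonneg fun b _ => hD0 b
  have hlen0 : (0 : ℝ) ≤ Γ.length := Nat.cast_nonneg _
  have hSsq : S ^ 2 ≤ (3 * (P.L : ℝ) / 2) ^ 2 * Bq := by
    have h1 : S ≤ (Γ.length : ℝ) * Real.sqrt Bq := hws
    have h2' : (Γ.length : ℝ) * Real.sqrt Bq ≤ (3 * (P.L : ℝ) / 2) * Real.sqrt Bq := mul_le_mul_of_nonneg_right hlen (Real.sqrt_nonneg _)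
    have h3 : S ≤ (3 * (P.L : ℝ) / 2) * Real.sqrt Bq := h1.trans h2'
    have h4 := pow_le_pow_left₀ hS0 h3 2
    rw [mul_pow, Real.sq_sqrt hBq0] at h4
    exact h4
  have htri : ‖((holAt V Γ : Matrix.specialUnitaryGroup (Fin 2) ℂ) : Matrix (Fin 2) (Fin 2) ℂ) * star ((holAt V₀ Γ : Matrix.specialUnitaryGroup (Fin 2) ℂ) : Matrix (Fin 2) (Fin 2) ℂ) - 1
        - covWalkSum V₀ ℓY Γ‖
      ≤ ‖((holAt V Γ : Matrix.specialUnitaryGroup (Fin 2) ℂ) : Matrix (Fin 2) (Fin 2) ℂ) * star ((holAt V₀ Γ : Matrix.specialUnitaryGroup (Fin 2) ℂ) : Matrix (Fin 2) (Fin 2) ℂ) - 1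
          - covWalkSum V₀ (pertVar V₀ V) Γ‖ + ‖covWalkSum V₀ (pertVar V₀ V) Γ - covWalkSum V₀ ℓY Γ‖ := by
    have := norm_add_le (((holAt V Γ : Matrix.specialUnitaryGroup (Fin 2) ℂ) : Matrix (Fin 2) (Fin 2) ℂ) * star ((holAt V₀ Γ : Matrix.specialUnitaryGroup (Fin 2) ℂ) : Matrix (Fin 2) (Fin 2) ℂ) - 1
        - covWalkSum V₀ (pertVar V₀ V) Γ) (covWalkSum V₀ (pertVar V₀ V) Γ - covWalkSum V₀ ℓY Γ)
    rwa [show ((holAt V Γ : Matrix.specialUnitaryGroup (Fin 2) ℂ) : Matrix (Fin 2) (Fin 2) ℂ) * star ((holAt V₀ Γ : Matrix.specialUnitaryGroup (Fin 2) ℂ) : Matrix (Fin 2) (Fin 2) ℂ) - 1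
        - covWalkSum V₀ (pertVar V₀ V) Γ + (covWalkSum V₀ (pertVar V₀ V) Γ - covWalkSum V₀ ℓY Γ)
        = ((holAt V Γ : Matrix.specialUnitaryGroup (Fin 2) ℂ) : Matrix (Fin 2) (Fin 2) ℂ) * star ((holAt V₀ Γ : Matrix.specialUnitaryGroup (Fin 2) ℂ) : Matrix (Fin 2) (Fin 2) ℂ) - 1
          - covWalkSum V₀ ℓY Γ by abel] at this
  have hlin' : ‖covWalkSum V₀ (pertVar V₀ V) Γ - covWalkSum V₀ ℓY Γ‖ ≤ 3 * (P.L : ℝ) / 2 * Dq :=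
    hlin.trans (mul_le_mul_of_nonneg_right hlen hDq0)
  nlinarith [htri, h2, hSsq, hlin']

/-! ## §3 ★★★ The stair row summed with the index mean -/

/-- ★★★ **THE STAIR ROW IN `ℓ¹`**: under the walk-mass window `Σ_Γ‖Y‖ ≤ 1` for every centre staircase,
`Σ_y |Idx|⁻¹Σ_i ‖V(Γ_i(y))V₀(Γ_i(y))* − 1 − covWalkSum V₀ ℓY Γ_i(y)‖ ≤ (9L²∕2)·Σ_y Σ_{b∈B(y)}‖Y b‖² + (3L∕2)·Σ_{b : PBond P k} D b` — the second-order stair remainder mass is the single-bar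
level mass plus the PLAIN tower's second-order single-bar remainder mass («(n3)₂-sym», displayed as `D`). [cite: Balaban1985Averaging, Prop. 3 (122)-(123) p.36; Balaban1987RG1, (0.3) p.252] -/
theorem sum_idxMean_stairRem2_le (hd : P.d = 3) (hk : k + 1 ≤ P.m + P.K) (V₀ V : GaugeField P k (Matrix.specialUnitaryGroup (Fin 2) ℂ))
    (ℓY : PBond P k → Matrix (Fin 2) (Fin 2) ℂ) (D : PBond P k → ℝ) (hD0 : ∀ b, 0 ≤ D b) (hD : ∀ b, ‖pertVar V₀ V b - ℓY b‖ ≤ D b)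
    (hm : ∀ (y : Site P (k + 1)) (i : Idx P), ((walk (emb y) (stairWord i.2.1 (off i.1))).map fun s => ‖pertVar V₀ V s.bond‖).sum ≤ 1) :
    ∑ y : Site P (k + 1), (Fintype.card (Idx P) : ℝ)⁻¹ * ∑ i : Idx P,
        ‖((holAt V (walk (emb y) (stairWord i.2.1 (off i.1))) : Matrix.specialUnitaryGroup (Fin 2) ℂ) : Matrix (Fin 2) (Fin 2) ℂ)
              * star ((holAt V₀ (walk (emb y) (stairWord i.2.1 (off i.1))) : Matrix.specialUnitaryGroup (Fin 2) ℂ) : Matrix (Fin 2) (Fin 2) ℂ) - 1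
            - covWalkSum V₀ ℓY (walk (emb y) (stairWord i.2.1 (off i.1)))‖
      ≤ 9 * (P.L : ℝ) ^ 2 / 2 * ∑ y : Site P (k + 1), ∑ b ∈ univ.filter (fun b : PBond P k => blockOf b.src = y), ‖pertVar V₀ V b‖ ^ 2
        + 3 * (P.L : ℝ) / 2 * ∑ b : PBond P k, D b := by
  have hcard : (0 : ℝ) < Fintype.card (Idx P) := Nat.cast_pos.2 Fintype.card_pos
  -- each index mean is at most the (index-free) pointwise right side
  have hy : ∀ y : Site P (k + 1), (Fintype.card (Idx P) : ℝ)⁻¹ * ∑ i : Idx P,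
        ‖((holAt V (walk (emb y) (stairWord i.2.1 (off i.1))) : Matrix.specialUnitaryGroup (Fin 2) ℂ) : Matrix (Fin 2) (Fin 2) ℂ)
              * star ((holAt V₀ (walk (emb y) (stairWord i.2.1 (off i.1))) : Matrix.specialUnitaryGroup (Fin 2) ℂ) : Matrix (Fin 2) (Fin 2) ℂ) - 1
            - covWalkSum V₀ ℓY (walk (emb y) (stairWord i.2.1 (off i.1)))‖
      ≤ 9 * (P.L : ℝ) ^ 2 / 2 * ∑ b ∈ univ.filter (fun b : PBond P k => blockOf b.src = y), ‖pertVar V₀ V b‖ ^ 2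
        + 3 * (P.L : ℝ) / 2 * ∑ b ∈ univ.filter (fun b : PBond P k => blockOf b.src = y), D b := by
    intro y
    set R : ℝ := 9 * (P.L : ℝ) ^ 2 / 2 * ∑ b ∈ univ.filter (fun b : PBond P k => blockOf b.src = y), ‖pertVar V₀ V b‖ ^ 2
        + 3 * (P.L : ℝ) / 2 * ∑ b ∈ univ.filter (fun b : PBond P k => blockOf b.src = y), D b with hR
    calc (Fintype.card (Idx P) : ℝ)⁻¹ * ∑ i : Idx P,
          ‖((holAt V (walk (emb y) (stairWord i.2.1 (off i.1))) : Matrix.specialUnitaryGroup (Fin 2) ℂ) : Matrix (Fin 2) (Fin 2) ℂ)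
                * star ((holAt V₀ (walk (emb y) (stairWord i.2.1 (off i.1))) : Matrix.specialUnitaryGroup (Fin 2) ℂ) : Matrix (Fin 2) (Fin 2) ℂ) - 1
              - covWalkSum V₀ ℓY (walk (emb y) (stairWord i.2.1 (off i.1)))‖
        ≤ (Fintype.card (Idx P) : ℝ)⁻¹ * ∑ _i : Idx P, R :=
          mul_le_mul_of_nonneg_left (Finset.sum_le_sum fun i _ => norm_stairRatio_sub_one_sub_lin_le hd hk V₀ V ℓY D hD0 hD y i (hm y i)) (by positivity)
      _ = R := by rw [Finset.sum_const, Finset.card_univ, nsmul_eq_mul, ← mul_assoc, inv_mul_cancel₀ hcard.ne', one_mul]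
  refine (Finset.sum_le_sum fun y _ => hy y).trans (le_of_eq ?_)
  rw [Finset.sum_add_distrib, ← Finset.mul_sum, ← Finset.mul_sum, sum_sum_filter_blockOf_eq D]

/-- ★★★ **THE `SR` LETTER OF ✓`Prop7FrameRem2Step.frameRem2_step_le`, SUMMED**: choosing the stair majorant `SR y i := (9L²∕2)·B(y) + (3L∕2)·D(y)` (§2), its index-mean sum is
`Σ_y |Idx|⁻¹Σ_i SR y i = (9L²∕2)·Σ_y B(y) + (3L∕2)·Σ_{b : PBond P k} D b`. [cite: Balaban1987RG1, (0.3)-(0.4) pp.252-253] -/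
theorem sum_idxMean_const_stairMajorant (Bq Dq : Site P (k + 1) → ℝ) (cB cD : ℝ) :
    ∑ y : Site P (k + 1), (Fintype.card (Idx P) : ℝ)⁻¹ * ∑ _i : Idx P, (cB * Bq y + cD * Dq y)
      = cB * ∑ y : Site P (k + 1), Bq y + cD * ∑ y : Site P (k + 1), Dq y := by
  have hcard : (0 : ℝ) < Fintype.card (Idx P) := Nat.cast_pos.2 Fintype.card_pos
  have e : ∀ y : Site P (k + 1), (Fintype.card (Idx P) : ℝ)⁻¹ * ∑ _i : Idx P, (cB * Bq y + cD * Dq y) = cB * Bq y + cD * Dq y := fun y => by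
    rw [Finset.sum_const, Finset.card_univ, nsmul_eq_mul, ← mul_assoc, inv_mul_cancel₀ hcard.ne', one_mul]
  rw [Finset.sum_congr rfl (fun y _ => e y), Finset.sum_add_distrib, Finset.mul_sum, Finset.mul_sum]

end Summit.QuantumFields.YangMills.Theorems.Prop7StairRem2Row

end
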